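import Summits.CriticalPhenomena.CardyFormulaZ2.Theses.CardyMonotoneApproach
import Summits.CriticalPhenomena.CardyFormulaZ2.Theorems.CardyWickAnisotropyBoxFamilyToCardyStubZ2BoxesToRectCardyPart1
import Summits.CriticalPhenomena.CardyFormulaZ2.Theorems.CardyWickAnisotropyBoxFamilyToCardyStubZ2BoxesToRectCardyPart4
import Literature.Probability.RandomPlanarGeometry.RectangleModulusLambda
import Literature.Probability.RandomPlanarGeometry.CrossRatioLamR
import Literature.Probability.RandomPlanarGeometry.KlebanZagierCrossing
import HarnessLib

/-!
# Stub `stub_z2BoxesToRectCardy` of line `birth`, crux `BoxFamilyToCardy` (stmt-CriticalPhenomena-14215)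

Step 2c of the known half of `BoxFamilyToCardy : AnisotropicBoxCardy → CardyFormulaZ2`
(`Cruxes/BoxFamilyToCardy/Lines/birth.lean`): from Cardy's value along the exact box-crossing
probabilities of bond-`ℤ²` at `p = 1/2` on the rational-aspect family,
`crossingProb half (p m) (q m − 1) → Π_h(p/q)` (`p, q ≥ 1`, `Π_h = KlebanZagier.cardyPi`), to Cardy's
formula for Smirnov's discretised corner-marked rectangles, i.e. the sibling target
`CardyMonotoneApproach.RectCardy` (stmt-CriticalPhenomena-5843) BY NAME.

Proof (all ingredients are tree theorems):
* part 1 (`rect_sideArcs`, = the sibling line's `RectValue … stub_sideArcs`): for `R` with carrier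
  `(0,w)×(0,h)` and marks `ih, 0, w, w + ih`, `R.arc 0` / `R.arc 2` are the closed left / right sides, so
  `bondDomainCrossingProb R δ` is the left–right crossing probability of the discretised box;
* parts 2–4 (`rect_boxSandwich`, = the sibling line's `RectValue … stub_boxSandwich`, with `P = Π_h`):
  that probability tends to `Π_h(w/h)` as `δ → 0⁺`, `Π_h` being continuous on `(0,∞)`
  (`continuousOn_cardyPi`: `Π_h = F ∘ λ(i·)` there, `continuousOn_lamR`, `continuousOn_cardyFunction_Ioo`);
* the value: `Π_h(w/h) = F(λ(i w/h)) = F(crossRatio x)` for every uniformizing datum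
  (`rectangle_crossRatio_eq_modularLambdaI`, Kleban–Zagier 2003 §3).
No definitions are introduced.

References: S. Smirnov, C. R. Acad. Sci. Paris 333 (2001) 239, §2 [Smirnov2001];
P. Kleban, D. Zagier, J. Stat. Phys. 113 (2003) 431, §3 [KlebanZagier2003].
-/

noncomputable section

open Filter Topology Set
open Literature.Probability.RandomPlanarGeometry
open Literature.Probability.Percolation (bondDomainCrossingProb discreteCrossingProb crossingProb half)
open Literature.Probability.RandomPlanarGeometry.KlebanZagier (cardyPi lamR modularLambdaI lamR_mem_Ioo
  modularLambdaI_eq_lamR)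
open Summit.CriticalPhenomena.CardyFormulaZ2.Theses.CardyMonotoneApproach (RectCardy)

namespace Summit.CriticalPhenomena.CardyFormulaZ2.Cruxes.BoxFamilyToCardy.Birth

/-- **Cardy's `Π_h` is continuous on `(0,∞)`**: there `Π_h(r) = F(λ(ir))` with `λ(i·)` continuous into
`(0,1)` and `F` continuous on `(0,1)`. [cite: KlebanZagier2003, §2–3] -/
theorem continuousOn_cardyPi : ContinuousOn cardyPi (Ioi 0) := by
  have h1 : ContinuousOn (fun r => cardyFunction (lamR r)) (Ioi 0) :=
    continuousOn_cardyFunction_Ioo.comp continuousOn_lamR fun r hr => lamR_mem_Ioo hr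
  refine h1.congr fun r hr => ?_
  show cardyFunction (modularLambdaI r) = cardyFunction (lamR r)
  rw [modularLambdaI_eq_lamR hr]

/-- **Stub 2c of line `birth` (crux `BoxFamilyToCardy`), proved: from the lattice boxes to Smirnov's
discretised rectangles.** If `crossingProb half (p m) (q m − 1) → Π_h(p/q)` for all `p, q ≥ 1`, then
`RectCardy`: for every corner-marked rectangle `R = (0,w)×(0,h)` (marks `ih, 0, w, w+ih`) and every
uniformizing datum `(φ, x)`, `bondDomainCrossingProb R δ → cardyFunction (crossRatio x)` as `δ → 0⁺`
(side arcs + lattice sandwich + `Π_h(w/h) = F(crossRatio x)`). [folklore] -/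
theorem stub_z2BoxesToRectCardy :
    (∀ p q : ℕ, 1 ≤ p → 1 ≤ q →
        Tendsto (fun m : ℕ ↦ crossingProb half (p * m) (q * m - 1)) atTop
          (𝓝 (cardyPi ((p : ℝ) / (q : ℝ))))) →
      RectCardy := by
  intro hfam R w h hw hh hcar hpt φ x hφx
  obtain ⟨h0, h2⟩ := rect_sideArcs R w h hw hh hcar hpt
  have hbox := rect_boxSandwich cardyPi continuousOn_cardyPi hfam w h hw hh
  have e : bondDomainCrossingProb R = fun δ : ℝ => discreteCrossingProb half
      (Set.Ioo (0:ℝ) w ×ℂ Set.Ioo (0:ℝ) h) δ {z : ℂ | z.re = 0 ∧ 0 ≤ z.im ∧ z.im ≤ h}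
      {z : ℂ | z.re = w ∧ 0 ≤ z.im ∧ z.im ≤ h} := by
    funext δ
    show discreteCrossingProb half R.carrier δ (R.arc 0) (R.arc 2) = _
    rw [hcar, h0, h2]
  rw [e, rectangle_crossRatio_eq_modularLambdaI R hw hh hcar hpt φ x hφx]
  exact hbox

end Summit.CriticalPhenomena.CardyFormulaZ2.Cruxes.BoxFamilyToCardy.Birth

end
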